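import Summits.QuantumAdvantage.AdviceFreeQNC0.AffBells36PairSliceS4
import Summits.QuantumAdvantage.AdviceFreeQNC0.AffBells23RingCond
import Summits.QuantumAdvantage.AdviceFreeQNC0.WindowLocalHard
import Summits.QuantumAdvantage.AdviceFreeQNC0.EliminationLogDegree
import HarnessLib

/-!
# AffBells36 — pair slicing, stub S3 PROVED: on every part the transported strategy has polylog degree
# (planner qa-qnc0-p1 g36, ROUND-35 §4.5–4.6, ask P-36d; skeleton `HOME/qa-qnc0-p1/exp36/PairSliceSkeleton36.lean`)

Prover qn-prover-3 g20.  `PairSkel.yOf` and the registered stub `PairSkel.S3` are repeated VERBATIM; `s3_holds : S3`.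

PROOF.  Fix the part through `a` (all walk coordinates outside the free set `F` = blind pair-firsts are frozen).
* `xOfU_flipAt`: flipping the walk coordinate `u_i` flips exactly the input pair `(x_i, x_{i+1})` (`adjFlip`).
* `blind_of_mem_freeSet`: for a free first `i` the pair is `Blind` for `γ` at every point of the part (the tie bit reads
  `u_{i−1}, u_{i+1}`, which are not pair-firsts, hence frozen).
* so a row ALIGNED at `i` keeps its linear form under the flip (`linForm_adjFlip_of_aligned`); by induction on the set of
  differing coordinates (`linForm_eq_of_agree`), `affBell β c (xOfU ·) g` restricted to the part depends only on the
  MISALIGNED free firsts of row `g` — at most `(log₂ (n+1))^C` coordinates — hence has degree `≤ (log₂(n+1))^C`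
  (`ind_mem_lowDeg_of_dependsOn`); `tGuess ∘ xOfU` is a xor of two affine coordinates (`ind_xOfU_mem`,
  `RingCond.hasDeg_comp_merge`); `hasDeg_xor` and `RingCond.degBook` give the exponent `(log₂ n)^{2C+1}`.
With S1/S2/S5 (skeleton, proved by the planner) and S4 (`AffBells36PairSliceS4`) this completes `PairAlignedHard` via the
skeleton's `pairAlignedHard_of`.  WHAT THIS IS NOT: the structural box `NearPerfectAligned` is untouched.
-/

noncomputable section

open Classical

namespace Summit.QuantumAdvantage.AdviceFreeQNC0.AffBells36

open Finset Literature.Computability.QuantumComplexity Literature.Computability.QuantumComplexity.RingHLF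
open Literature.Computability.MetaComplexity Literature.Computability.MetaComplexity.Smolensky
open AffBells22 AffBells23

namespace PairSkel

variable {n : ℕ}

/-- the transported walk strategy of the affine strategy `(β, c)` (`rel_iff_ringWinU`). (verbatim) -/
def yOf (β : Fin (n + 1) → Fin (n + 1) → ZMod 3) (c : Fin (n + 1) → ZMod 3) :
    Fin (n + 1) → (Fin n → Bool) → Bool :=
  fun g u => xor (affBell β c (xOfU u) g) (tGuess (xOfU u) g)

/-- S3 (verbatim, the registered stub): on every part the transported strategy has polylog degree in the free bits. -/
def S3 : Prop := ∀ n : ℕ, 4 ^ 3 ≤ n → ∀ (C : ℕ) (β : Fin (n + 1) → Fin (n + 1) → ZMod 3) (c : Fin (n + 1) → ZMod 3)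
  (γ : Fin (n + 1) → ZMod 3) (P : Finset (Fin (n + 1))), IsPairing P →
  (∀ k, (misaligned β γ P k).card ≤ (Nat.log 2 (n + 1)) ^ C) → ∀ (a : Fin n → Bool) (g : Fin (n + 1)),
    HasDeg (fun u => yOf β c g (subcubeMerge (univ \ freeSet γ P a) a u)) ((Nat.log 2 n) ^ (2 * C + 1))

/-! ### Flipping a walk coordinate flips an input pair -/

/-- The values of `uExt` after flipping the walk coordinate `i`. -/
theorem uExt_flipAt (i : Fin n) (w : Fin n → Bool) (m : ℕ) :
    uExt (flipAt i w) m = if m = i.val then !uExt w m else uExt w m := by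
  by_cases hm : m = i.val
  · rw [if_pos hm, hm]; exact uExt_flipAt_self i w
  · rw [if_neg hm]; exact uExt_flipAt_of_ne i w hm

/-- Pointwise form: flipping `u_i` flips exactly `x_i` and `x_{i+1}`. -/
theorem xOfU_flipAt_apply (i : Fin n) (w : Fin n → Bool) (j : Fin (n + 1)) :
    xOfU (flipAt i w) j = if (j.val = i.val ∨ j.val = i.val + 1) then !xOfU w j else xOfU w j := by
  unfold xOfU
  rw [uExt_flipAt i w j.val]
  by_cases h0 : j.val = 0
  · have A : (if j.val = 0 then false else uExt (flipAt i w) (j.val - 1)) = false := if_pos h0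
    have B : (if j.val = 0 then false else uExt w (j.val - 1)) = false := if_pos h0
    rw [A, B]
    by_cases h1 : j.val = i.val
    · rw [if_pos h1, if_pos (Or.inl h1)]
      cases uExt w j.val <;> rfl
    · rw [if_neg h1, if_neg (not_or.mpr ⟨h1, by omega⟩)]
  · have A : (if j.val = 0 then false else uExt (flipAt i w) (j.val - 1)) = uExt (flipAt i w) (j.val - 1) :=
      if_neg h0
    have B : (if j.val = 0 then false else uExt w (j.val - 1)) = uExt w (j.val - 1) := if_neg h0
    rw [A, B, uExt_flipAt i w (j.val - 1)]
    by_cases h1 : j.val = i.val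
    · rw [if_pos h1, if_neg (show ¬ (j.val - 1 = i.val) by omega), if_pos (Or.inl h1)]
      cases uExt w j.val <;> cases uExt w (j.val - 1) <;> rfl
    · rw [if_neg h1]
      by_cases h2 : j.val = i.val + 1
      · rw [if_pos (show j.val - 1 = i.val by omega), if_pos (Or.inr h2)]
        cases uExt w j.val <;> cases uExt w (j.val - 1) <;> rfl
      · rw [if_neg (show ¬ (j.val - 1 = i.val) by omega), if_neg (not_or.mpr ⟨h1, h2⟩)]

/-- `xOfU (flipAt i w) = adjFlip i (xOfU w)`. -/
theorem xOfU_flipAt (i : Fin n) (w : Fin n → Bool) :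
    xOfU (flipAt i w) = adjFlip i.castSucc (by simp) (xOfU w) := by
  funext j
  have hc : (j = i.castSucc ∨ j = ⟨(i.castSucc : Fin (n + 1)).val + 1, by simp⟩) ↔ (j.val = i.val ∨ j.val = i.val + 1) := by
    simp only [Fin.ext_iff, Fin.val_castSucc]
  rw [xOfU_flipAt_apply]
  unfold adjFlip
  by_cases h : (j.val = i.val ∨ j.val = i.val + 1)
  · rw [if_pos h, if_pos (hc.mpr h)]
  · rw [if_neg h, if_neg (fun h' => h (hc.mp h'))]

/-! ### Blindness is constant on a part -/

/-- For a pair-first `i`, the neighbours `i − 1`, `i + 1` are not pair-firsts, so a point of the part through `a`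
(agreeing with `a` off the free set) has the tie bit of `a` at `i`. -/
theorem tiedAt_eq_of_agree (γ : Fin (n + 1) → ZMod 3) (P : Finset (Fin (n + 1))) (hP : IsPairing P)
    (a w : Fin n → Bool) (hw : ∀ j, j ∉ freeSet γ P a → w j = a j) (i : Fin n) (hi : i.castSucc ∈ P) :
    tiedAt w i.val = tiedAt a i.val := by
  have hnotF : ∀ j : Fin n, (j.val = i.val + 1 ∨ j.val + 1 = i.val) → j ∉ freeSet γ P a := by
    intro j hj hmem
    unfold freeSet at hmem
    rw [mem_filter] at hmem
    have hjP := hmem.2.1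
    rcases hj with h | h
    · exact (hP _ hi).2 _ hjP (by simp [h])
    · exact (hP _ hjP).2 _ hi (by simp; omega)
  unfold tiedAt
  have e1 : uExt w (i.val + 1) = uExt a (i.val + 1) := by
    unfold uExt
    by_cases h : i.val + 1 < n
    · rw [dif_pos h, dif_pos h]; exact hw ⟨i.val + 1, h⟩ (hnotF _ (Or.inl rfl))
    · rw [dif_neg h, dif_neg h]
  have e2 : (if i.val = 0 then false else uExt w (i.val - 1)) = (if i.val = 0 then false else uExt a (i.val - 1)) := by
    by_cases h0 : i.val = 0
    · rw [if_pos h0, if_pos h0]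
    · rw [if_neg h0, if_neg h0]
      unfold uExt
      have h : i.val - 1 < n := by omega
      rw [dif_pos h, dif_pos h, hw ⟨i.val - 1, h⟩ (hnotF _ (Or.inr (by simp; omega)))]
  rw [e1, e2]

/-- On the part through `a`, every free pair-first is `Blind` for `γ` at the input point. -/
theorem blind_of_mem_freeSet (γ : Fin (n + 1) → ZMod 3) (P : Finset (Fin (n + 1))) (hP : IsPairing P)
    (a w : Fin n → Bool) (hw : ∀ j, j ∉ freeSet γ P a → w j = a j) (i : Fin n) (hi : i ∈ freeSet γ P a) :
    Blind γ (xOfU w) i.castSucc (by simp) := by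
  have hiF := hi
  unfold freeSet at hi
  rw [mem_filter] at hi
  obtain ⟨-, hiP, hbl⟩ := hi
  have ht := tiedAt_eq_of_agree γ P hP a w hw i hiP
  -- the tie bit of `w` at `i` in terms of `xOfU w`
  have hx : (xOfU w i.castSucc = xOfU w ⟨(i.castSucc : Fin (n + 1)).val + 1, by simp⟩) ↔ tiedAt w i.val = true := by
    unfold xOfU tiedAt
    simp only [Fin.val_castSucc, Nat.add_eq_zero_iff, one_ne_zero, and_false, if_false,
      show i.val + 1 - 1 = i.val from by omega]
    cases uExt w i.val <;> cases uExt w (i.val + 1) <;> cases (if i.val = 0 then false else uExt w (i.val - 1)) <;> decide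
  have hg0 : gamN γ i.val = γ i.castSucc := by unfold gamN; rw [dif_pos (by omega)]; rfl
  have hg1 : gamN γ (i.val + 1) = γ ⟨(i.castSucc : Fin (n + 1)).val + 1, by simp⟩ := by
    unfold gamN; rw [dif_pos (by omega)]
    congr 1
  unfold Blind
  unfold blindAt at hbl
  rw [hg0, hg1, ← ht] at hbl
  rcases hbl with ⟨h1, h2⟩ | ⟨h1, h2⟩
  · exact Or.inl ⟨hx.mpr h1, h2⟩
  · refine Or.inr ⟨fun h => ?_, h2⟩
    have := hx.mp h; rw [h1] at this; exact Bool.false_ne_true this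

/-! ### Aligned rows do not see the free aligned coordinates -/

/-- Flipping a free first at which row `g` is aligned does not change the row's linear form (on the part). -/
theorem linForm_flipAt (β : Fin (n + 1) → Fin (n + 1) → ZMod 3) (γ : Fin (n + 1) → ZMod 3) (P : Finset (Fin (n + 1)))
    (hP : IsPairing P) (a w : Fin n → Bool) (hw : ∀ j, j ∉ freeSet γ P a → w j = a j) (g : Fin (n + 1)) (i : Fin n)
    (hi : i ∈ freeSet γ P a) (hal : RowAligned β γ g i.castSucc) :
    linForm (β g) (xOfU (flipAt i w)) = linForm (β g) (xOfU w) := by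
  rw [xOfU_flipAt]
  obtain ⟨l, hl1, hl2⟩ := hal (by simp)
  exact linForm_adjFlip_of_aligned (β g) γ i.castSucc (by simp) (xOfU w) (blind_of_mem_freeSet γ P hP a w hw i hi) l hl1 hl2

/-- **Junta property**: on the part, the linear form of row `g` depends only on the misaligned free firsts. -/
theorem linForm_eq_of_agree (β : Fin (n + 1) → Fin (n + 1) → ZMod 3) (γ : Fin (n + 1) → ZMod 3) (P : Finset (Fin (n + 1)))
    (hP : IsPairing P) (a : Fin n → Bool) (g : Fin (n + 1)) :
    ∀ (T : Finset (Fin n)), (∀ i ∈ T, i ∈ freeSet γ P a ∧ RowAligned β γ g i.castSucc) →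
    ∀ w w' : Fin n → Bool, (∀ j, j ∉ freeSet γ P a → w j = a j) → (∀ j, j ∉ freeSet γ P a → w' j = a j) →
    (∀ j, j ∉ T → w j = w' j) → linForm (β g) (xOfU w) = linForm (β g) (xOfU w') := by
  intro T
  induction T using Finset.induction_on with
  | empty =>
    intro _ w w' _ _ hww'
    have : w = w' := funext fun j => hww' j (by simp)
    rw [this]
  | insert i T hiT ih =>
    intro hT w w' hw hw' hww'
    -- adjust `w` at `i` so that it agrees with `w'` there
    set w'' : Fin n → Bool := if w i = w' i then w else flipAt i w with hw''
    have h1 : linForm (β g) (xOfU w) = linForm (β g) (xOfU w'') := by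
      by_cases h : w i = w' i
      · simp only [hw'', h, if_true]
      · simp only [hw'', h, if_false]
        exact (linForm_flipAt β γ P hP a w hw g i (hT i (mem_insert_self i T)).1 (hT i (mem_insert_self i T)).2).symm
    rw [h1]
    refine ih (fun j hj => hT j (mem_insert_of_mem hj)) w'' w' ?_ hw' ?_
    · intro j hj
      by_cases h : w i = w' i
      · simp only [hw'', h, if_true]; exact hw j hj
      · simp only [hw'', h, if_false]
        unfold flipAt
        rw [Function.update_of_ne]
        · exact hw j hj
        · intro hji; subst hji; exact hj (hT j (mem_insert_self j T)).1
    · intro j hj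
      by_cases hji : j = i
      · subst hji
        by_cases h : w j = w' j
        · simp only [hw'', h, if_true]
        · simp only [hw'', h, if_false]
          unfold flipAt
          rw [Function.update_self]
          cases hwj : w j <;> cases hwj' : w' j <;> simp_all
      · have hjT : j ∉ insert i T := by rw [mem_insert]; push Not; exact ⟨hji, hj⟩
        by_cases h : w i = w' i
        · simp only [hw'', h, if_true]; exact hww' j hjT
        · simp only [hw'', h, if_false]
          unfold flipAt
          rw [Function.update_of_ne hji]
          exact hww' j hjT

/-! ### S3 -/

/-- **S3 PROVED.** -/
theorem s3_holds : S3 := by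
  intro n hn C β c γ P hP hmis a g
  set F := freeSet γ P a with hF
  set S : Finset (Fin n) := univ \ F with hS
  set M : Finset (Fin n) := F.filter fun i => ¬ RowAligned β γ g i.castSucc with hM
  -- the affine bell part is a junta on `M`
  have hmerge : ∀ u : Fin n → Bool, ∀ j, j ∉ F → subcubeMerge S a u j = a j := by
    intro u j hj
    unfold subcubeMerge
    rw [if_pos (by rw [hS, mem_sdiff]; exact ⟨mem_univ _, hj⟩)]
  have hdep : ∀ u v : Fin n → Bool, (∀ i ∈ M, u i = v i) →
      affBell β c (xOfU (subcubeMerge S a u)) g = affBell β c (xOfU (subcubeMerge S a v)) g := by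
    intro u v huv
    rw [affBell_eq_linForm, affBell_eq_linForm]
    have key := linForm_eq_of_agree β γ P hP a g (F.filter fun i => RowAligned β γ g i.castSucc)
      (fun i hi => by rw [mem_filter] at hi; exact ⟨hi.1, hi.2⟩)
      (subcubeMerge S a u) (subcubeMerge S a v) (hmerge u) (hmerge v) ?_
    · rw [key]
    · intro j hj
      by_cases hjF : j ∈ F
      · -- `j` free and not in the aligned set ⇒ `j ∈ M`
        have hjM : j ∈ M := by
          rw [hM, mem_filter]; exact ⟨hjF, fun h => hj (by rw [mem_filter]; exact ⟨hjF, h⟩)⟩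
        unfold subcubeMerge
        have hjS : j ∉ S := by rw [hS, mem_sdiff]; push Not; exact fun _ => hjF
        rw [if_neg hjS, if_neg hjS]
        exact huv j hjM
      · rw [hmerge u j hjF, hmerge v j hjF]
  have hM_card : M.card ≤ (Nat.log 2 (n + 1)) ^ C := by
    refine le_trans ?_ (hmis g)
    unfold misaligned
    refine card_le_card_of_injOn Fin.castSucc ?_ (fun i _ j _ h => Fin.castSucc_injective _ h)
    intro i hi
    rw [mem_coe, hM, mem_filter, hF] at hi
    unfold freeSet at hi
    rw [mem_filter] at hi
    rw [mem_coe, mem_filter]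
    exact ⟨hi.1.2.1, hi.2⟩
  have hdeg1 : HasDeg (fun u => affBell β c (xOfU (subcubeMerge S a u)) g) M.card := by
    unfold HasDeg
    exact ind_mem_lowDeg_of_dependsOn (F := ZMod 2) M _ hdep
  -- the guess part is affine
  have hdeg2 : HasDeg (fun u => tGuess (xOfU (subcubeMerge S a u)) g) 1 := by
    unfold tGuess
    exact hasDeg_xor (RingCond.hasDeg_comp_merge S a (h := fun u => xOfU u g) (ind_xOfU_mem g))
      (RingCond.hasDeg_comp_merge S a (h := fun u => xOfU u (nxt g)) (ind_xOfU_mem (nxt g)))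
  -- exponent bookkeeping
  have hbook := RingCond.degBook (p := 2) (le_refl 2) (by norm_num at hn ⊢; omega) C
  have hD1 : M.card ≤ (Nat.log 2 n) ^ (2 * C + 1) := by omega
  have hD2 : 1 ≤ (Nat.log 2 n) ^ (2 * C + 1) := by omega
  unfold yOf
  exact hasDeg_xor (lowDeg_mono hD1 hdeg1) (lowDeg_mono hD2 hdeg2)

end PairSkel

end Summit.QuantumAdvantage.AdviceFreeQNC0.AffBells36

end
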